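import Literature.AnabelianGeometry.AbsoluteAnabelian.PanalocalTheatersStructural
import Literature.NumberTheory.GaloisRepresentations.AbsDecompositionGroupsInfiniteIndex
import HarnessLib

/-!
# [AbsTopIII] Def 5.1 (i): the `G_F`-ORBITS of the genuine pro-set `V⊚(F̄/F)` — `⊚` is the unique element with a
# finite orbit; every local element has a decomposition group of infinite index

S. Mochizuki, *Topics in Absolute Anabelian Geometry III* [MochizukiAbsTopIII2015], Def 5.1 (i) p. 113 ("`V(F̄/F)` … the
pro-sets of valuations", i.e. the inverse limit of the FINITE-to-one-free systems `V(K)`, `K ⊆ F̄` finite over `F`),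
(iii) p. 115.  Cell `abc-iut`, seat abc-iut-f-053 (gen 3); proof-only sequel to abc-iut-L4-d2's `NumberFieldValuationProSet.lean`
and abc-iut-f-104's `PanalocalTheatersStructural.lean` / `NumberFieldValuationProSetDecomposition.lean` (which prove "`⊚` is the
unique FIXED element" and "only `⊚` has an OPEN decomposition group").  THIS FILE adds the orbit / index form at the genuine
pro-set `NumberField.valuationProSet F` of a number field `F`:

* `index_decomp_eq_zero_of_mem_non` — **`[G_F : D_v] = ∞` for nonarchimedean `v`** (elementary route:
  `ValuationSubring.index_stabilizer_eq_zero_of_ne_top`, infinitely many conjugate primes);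
* `index_decomp_eq_zero_of_mem_arc` — **`[G_F : D_w] = ∞` for archimedean `w`** (`|D_w| ≤ 2`, `G_F` infinite);
* `infinite_orbit_of_mem_non`, `infinite_orbit_of_mem_arc`, `infinite_orbit_of_ne_generic` — **every local element has an
  INFINITE `G_F`-orbit** (the fibres of `V(F̄/F) → V(F)` are infinite);
* `orbit_generic`, **`finite_orbit_iff_eq_generic`**, `index_decomp_ne_zero_iff_eq_generic` — `⊚` is the UNIQUE element of
  `V⊚(F̄/F)` with a finite orbit / a finite-index decomposition group.

HONEST SCOPE: statements about the genuine object only; classical algebraic number theory; theorems only; nothing here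
bears on [IUTchIII] Cor. 3.12; no side is taken.
-/

noncomputable section

open scoped Pointwise

namespace Literature.AnabelianGeometry.AbsoluteAnabelian

namespace NumberFieldValuationProSet

open Field NumberField Literature.NumberTheory.GaloisRepresentations

variable (F : Type) [Field F]

/-- The decomposition group of the pro-set IS the stabiliser (definition of `GaloisProSet.decomp`), so its index is
the cardinality of the orbit. [cite: MochizukiAbsTopIII2015, Def 5.1 (iii) p. 115] -/
theorem index_decomp_eq_ncard_orbit (v : (NumberField.valuationProSet F).carrier) :
    ((NumberField.valuationProSet F).decomp v).index = (MulAction.orbit (absoluteGaloisGroup F) v).ncard := by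
  rw [GaloisProSet.decomp, MulAction.index_stabilizer]

/-- The orbit of `⊚` is `{⊚}`. [cite: MochizukiAbsTopIII2015, Def 5.1 (i) p. 113] -/
theorem orbit_generic :
    MulAction.orbit (absoluteGaloisGroup F) (NumberField.valuationProSet F).generic =
      {(NumberField.valuationProSet F).generic} := by
  ext v
  rw [MulAction.mem_orbit_iff, Set.mem_singleton_iff]
  constructor
  · rintro ⟨σ, rfl⟩
    exact (NumberField.valuationProSet F).smul_generic σ
  · rintro rfl
    exact ⟨1, one_smul _ _⟩

/-- The decomposition group of a nonarchimedean local element `A` (a valuation ring `A ≠ F̄`) IS the stabiliser of `A`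
in `G_F`, as a subgroup. [cite: MochizukiAbsTopIII2015, Def 5.1 (iii) p. 115] -/
theorem decomp_inr_inl_eq_stabilizer (A : NonArch F) :
    (NumberField.valuationProSet F).decomp (Sum.inr (Sum.inl A)) = MulAction.stabilizer (absoluteGaloisGroup F) A.1 := by
  ext σ
  rw [mem_decomp_inr_inl_iff, MulAction.mem_stabilizer_iff]

variable [NumberField F]

/-- **`[G_F : D_v] = ∞` for a nonarchimedean local element** of `V⊚(F̄/F)` (index `0` in Mathlib's convention):
infinitely many primes of `F̄` lie over the prime of `F` under `v` (`ValuationSubring.index_stabilizer_eq_zero_of_ne_top`).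
[cite: MochizukiAbsTopIII2015, Def 5.1 (iii) p. 115] [cite: NeukirchANT1999, Ch. II §8] -/
theorem index_decomp_eq_zero_of_mem_non (v : (NumberField.valuationProSet F).carrier)
    (hv : v ∈ (NumberField.valuationProSet F).non) : ((NumberField.valuationProSet F).decomp v).index = 0 := by
  obtain ⟨A, rfl⟩ := hv
  rw [decomp_inr_inl_eq_stabilizer]
  exact ValuationSubring.index_stabilizer_eq_zero_of_ne_top A.1 A.2

/-- **`[G_F : D_w] = ∞` for an archimedean local element** of `V⊚(F̄/F)`: `D_w` is finite (order `≤ 2`,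
`finite_decomp_of_mem_arc`) while `G_F` is infinite (`NumberField.infinite_absoluteGaloisGroup`).
[cite: MochizukiAbsTopIII2015, Def 5.1 (iii) p. 115] -/
theorem index_decomp_eq_zero_of_mem_arc (v : (NumberField.valuationProSet F).carrier)
    (hv : v ∈ (NumberField.valuationProSet F).arc) : ((NumberField.valuationProSet F).decomp v).index = 0 := by
  by_contra h
  have hfin : ((NumberField.valuationProSet F).decomp v : Set (absoluteGaloisGroup F)).Finite :=
    finite_decomp_of_mem_arc F v hv
  haveI : Finite ((NumberField.valuationProSet F).decomp v) := hfin.to_subtype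
  have hcard := ((NumberField.valuationProSet F).decomp v).card_mul_index
  haveI := NumberField.infinite_absoluteGaloisGroup F
  have h0 : Nat.card (absoluteGaloisGroup F) = 0 := Nat.card_eq_zero_of_infinite
  rw [h0] at hcard
  rcases mul_eq_zero.mp hcard with h1 | h1
  · exact (Nat.card_pos (α := (NumberField.valuationProSet F).decomp v)).ne' h1
  · exact h h1

/-- **`[G_F : D_v] = ∞` for every local (= non-generic) element** of `V⊚(F̄/F)`.
[cite: MochizukiAbsTopIII2015, Def 5.1 (iii) p. 115] -/
theorem index_decomp_eq_zero_of_ne_generic (v : (NumberField.valuationProSet F).carrier)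
    (hv : v ≠ (NumberField.valuationProSet F).generic) : ((NumberField.valuationProSet F).decomp v).index = 0 := by
  rcases (NumberField.valuationProSet F).eq_generic_or_mem v with h | h | h
  · exact absurd h hv
  · exact index_decomp_eq_zero_of_mem_non F v h
  · exact index_decomp_eq_zero_of_mem_arc F v h

/-- **Every nonarchimedean local element of `V⊚(F̄/F)` has an INFINITE `G_F`-orbit** — infinitely many primes of `F̄`
over each finite prime of `F`. [cite: MochizukiAbsTopIII2015, Def 5.1 (i) p. 113] [cite: NeukirchANT1999, Ch. II §8] -/
theorem infinite_orbit_of_ne_generic (v : (NumberField.valuationProSet F).carrier)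
    (hv : v ≠ (NumberField.valuationProSet F).generic) : (MulAction.orbit (absoluteGaloisGroup F) v).Infinite := by
  intro hfin
  have h := index_decomp_eq_zero_of_ne_generic F v hv
  rw [index_decomp_eq_ncard_orbit, Set.ncard_eq_zero hfin] at h
  exact (Set.nonempty_iff_ne_empty.mp ⟨v, MulAction.mem_orbit_self v⟩) h

/-- Every nonarchimedean local element has an infinite orbit. [cite: MochizukiAbsTopIII2015, Def 5.1 (i) p. 113] -/
theorem infinite_orbit_of_mem_non (v : (NumberField.valuationProSet F).carrier)
    (hv : v ∈ (NumberField.valuationProSet F).non) : (MulAction.orbit (absoluteGaloisGroup F) v).Infinite :=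
  infinite_orbit_of_ne_generic F v fun h => (NumberField.valuationProSet F).generic_notMem_non (h ▸ hv)

/-- Every archimedean local element has an infinite orbit (infinitely many infinite places of `F̄` over each infinite
place of `F`). [cite: MochizukiAbsTopIII2015, Def 5.1 (i) p. 113] -/
theorem infinite_orbit_of_mem_arc (v : (NumberField.valuationProSet F).carrier)
    (hv : v ∈ (NumberField.valuationProSet F).arc) : (MulAction.orbit (absoluteGaloisGroup F) v).Infinite :=
  infinite_orbit_of_ne_generic F v fun h => (NumberField.valuationProSet F).generic_notMem_arc (h ▸ hv)

/-- **`⊚` is the UNIQUE element of `V⊚(F̄/F)` with a finite `G_F`-orbit.** [cite: MochizukiAbsTopIII2015, Def 5.1 (i) p. 113] -/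
theorem finite_orbit_iff_eq_generic (v : (NumberField.valuationProSet F).carrier) :
    (MulAction.orbit (absoluteGaloisGroup F) v).Finite ↔ v = (NumberField.valuationProSet F).generic := by
  refine ⟨fun h => ?_, ?_⟩
  · by_contra hv
    exact infinite_orbit_of_ne_generic F v hv h
  · rintro rfl
    rw [orbit_generic]
    exact Set.finite_singleton _

/-- **`⊚` is the UNIQUE element of `V⊚(F̄/F)` whose decomposition group has finite index.**
[cite: MochizukiAbsTopIII2015, Def 5.1 (iii) p. 115] -/
theorem index_decomp_ne_zero_iff_eq_generic (v : (NumberField.valuationProSet F).carrier) :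
    ((NumberField.valuationProSet F).decomp v).index ≠ 0 ↔ v = (NumberField.valuationProSet F).generic := by
  refine ⟨fun h => ?_, ?_⟩
  · by_contra hv
    exact h (index_decomp_eq_zero_of_ne_generic F v hv)
  · rintro rfl
    rw [decomp_generic, Subgroup.index_top]
    exact one_ne_zero

end NumberFieldValuationProSet

end Literature.AnabelianGeometry.AbsoluteAnabelian

end
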